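import Literature.NumberTheory.Automorphic.RankinSelbergLocalUniqueness
import HarnessLib

/-!
# Proofs for `RankinSelbergLocal`: the constant of `ε(s, π × π', ψ)` — reductions, and the
`μ = 0` degeneration of the literal named fact

Topic `Literature/NumberTheory/Automorphic`; vocabulary of `RankinSelbergLocal.lean`
(`HasRSLFactor`, `HasRSGamma`, `HasRSEpsilon`, `rsZeta`, `rsZetaTilde`, `tildeFn`, `weylNM`,
`evalAtQ`, `rsLRat`, `EqOnRightHalfPlane`, and the named facts `existsUnique_hasRSEpsilon`,
`hasRSEpsilon_ne_zero`). A *proofs* file: theorems only, no new definitions. Companions: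
`RankinSelbergLocalProofs` (`W ↦ W̃`, the long Weyl element), `RankinSelbergLocalUniqueness`
(uniqueness halves of `L`, `γ`, `ε`; sampling lemmas reused here; it records the same
measure-hypotheses defect and proves the `ν = 0` failures — this file proves the `μ = 0` one).

Target of the provefact pass: `Literature.NumberTheory.Automorphic.hasRSEpsilon_ne_zero`
("`e ≠ 0` for `ε(s, π × π', ψ) = e q^{-as}`"; Jacquet–Piatetski-Shapiro–Shalika 1983,
Thm. 2.7 (iii) with (2.1), (2.7); Cogdell, *Analytic theory of `L`-functions for `GL_n`*, in
Bernstein–Gelbart (eds.), §3.1, Thm. 3.1–3.2 and the paragraph after Thm. 3.2: "`ε(s, π × π', ψ)`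
is a monomial function of the form `c q^{-fs}`"). What is proved here, sorry-free:

1. `tateEpsilonRat_zero_left`, `hasRSEpsilon_zero_iff_hasRSGamma_zero`, `hasRSEpsilon_zero_iff`:
   with constant `e = 0` the monomial `e T^a` is `0 ∈ ℂ(T)`, so `HasRSEpsilon … 0 a` says
   `γ = 0` and does not depend on `a`.
2. `hasRSEpsilon_ne_zero_of_existsUnique_hasRSEpsilon`: the sibling named fact
   `existsUnique_hasRSEpsilon` (uniqueness of the pair `(e, a)`, same theorem of JPSS) implies
   `hasRSEpsilon_ne_zero` — if `(0, a)` were `ε`-data, so would be `(0, a + 1)`.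
3. `rsZetaTilde_eq_zero_of_hasRSGamma_zero`: `γ = 0` forces every tilde integral
   `Ψ̃(t; ρ(w_{n,m}) W̃, W̃')` of the functional equation to vanish for `re t ≫ 0`; hence
   (`HasRSEpsilon.ne_zero_of_tilde_span`, `hasRSEpsilon_ne_zero_of_tilde_span`) **the printed
   argument**: `e ≠ 0` as soon as these tilde integrals span a NON-ZERO fractional ideal, i.e.
   some finite `ℂ(q^{-s})`-combination of them equals `P(q^{-s})⁻¹`, `P(0) ≠ 0`, on a right
   half-plane — which is JPSS Thm. 2.7 (ii) ("the integrals `Ψ(s; W, W'; j)` span the fractional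
   ideal `L(s, π × π') ℂ[q^{-s}, q^{s}] ∋ L`, for every `j`", here `j = n - m - 1`) applied to
   `π^ι = π ∘ ᵗ(·)⁻¹`, `π'^ι` (the functions `ρ(w_{n,m}) W̃`, `W̃'` are exactly the Whittaker
   functions of these twists; the twist bookkeeping is left to a sibling file). The analytic
   input — convergence and rationality of the `j = n - m - 1` integrals and `1 ∈ I(π, π')`
   (Cogdell, loc. cit., §3.1 items 1–3 and "each of these fractional ideals contain 1") — is a
   theory of its own (no `p`-adic integration of Whittaker functions exists in Mathlib), so the
   hypothesis is kept explicit; the `evalAtQ` book-keeping (sample points `s = j ∈ ℕ` off the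
   poles, `P(q^{-j})⁻¹ ≠ 0`) is that of `RankinSelbergLocalUniqueness`
   (`exists_forall_lt_re_and_eval_ne_zero`, `eval_rsLRat_ne_zero`, `evalAtQ_natCast`).
4. **The literal fact is mis-stated** (M5 mechanical rewrite): `hasRSEpsilon_ne_zero` is a
   `def … : Prop` abstracting only the section variables its body uses, so the standing
   hypotheses `[μ.IsAddHaarMeasure]`, `[SMulInvariantMeasure … ν]`, `[IsFiniteMeasureOnCompacts ν]`,
   `[ν.IsOpenPosMeasure]`, `[BorelSpace …]` of the sorried theorem it replaces were dropped and
   `μ`, `ν` are ARBITRARY measures. At `μ = 0` (and `1 ≤ m`, `2 ≤ n - m`, so that the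
   `x`-integral of `Ψ_{n-m-1}` is against the zero measure) every tilde integral vanishes
   (`rsZetaTilde_measure_zero`), the functional equation holds with `γ = 0`
   (`hasRSGamma_zero_measure_zero`), `(0, a)` is `ε`-data for every `a`
   (`hasRSEpsilon_zero_measure_zero`), and the literal fact FAILS
   (`not_hasRSEpsilon_ne_zero_measure_zero`) for any irreducible admissible generic `π`, `π'`
   having the two `L`-factor statements of JPSS Thm. 2.7 (i)–(ii) at `ν` and a central character
   for `π'` (Schur) — all of which the literature guarantees at the invariant `ν`. The corrected
   statement (Haar `μ`, invariant `ν` as binders) is vendored separately; the four sibling facts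
   `existsUnique_hasRSLFactor`, `existsUnique_hasRSGamma`, `hasRSLFactor_of_isSatakeParameter`,
   `existsUnique_hasRSEpsilon` lost the same binders (they are false at `ν = 0`).

## References

* H. Jacquet, I. I. Piatetski-Shapiro, J. A. Shalika, *Rankin–Selberg convolutions*,
  Amer. J. Math. 105 (1983) 367–464, doi:10.2307/2374264, §2 (2.1), (2.7) Theorem.
  [JacquetPiatetskiShapiroShalika1983]
* J. W. Cogdell, *Analytic theory of `L`-functions for `GL_n`*, in: J. Bernstein, S. Gelbart
  (eds.), *An Introduction to the Langlands Program*, Birkhäuser (2003/2004), §3.1,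
  Thm. 3.1, Thm. 3.2. [CogdellAnalyticTheory2004]
-/

open Matrix MeasureTheory Polynomial
open Literature.NumberTheory.GaloisRepresentations.IsNonarchimedeanLocalField

noncomputable section

namespace Literature.NumberTheory.Automorphic


/-! ### `ε`-data with vanishing constant: `γ = 0` -/

section EpsilonZero

variable {F : Type*} [Field F] [ValuativeRel F] [TopologicalSpace F]
  [IsNonarchimedeanLocalField F] {n m : ℕ}
  {V : Type*} [AddCommGroup V] [Module ℂ V] {V' : Type*} [AddCommGroup V'] [Module ℂ V']
  {hmn : m < n} {π : Representation ℂ (GL (Fin n) F) V} {π' : Representation ℂ (GL (Fin m) F) V'}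
  {ψ : AddChar F Circle}
  [MeasurableSpace (GL (Fin m) F ⧸ upperUnitriangular (Fin m) F)]
  {ν : Measure (GL (Fin m) F ⧸ upperUnitriangular (Fin m) F)}
  [MeasurableSpace F] {μ : Measure F}

/-- `ε`-monomial with constant `0`: `0 · T^a = 0` in `ℂ(T)`. [folklore] -/
theorem tateEpsilonRat_zero_left (a : ℤ) : tateEpsilonRat 0 a = 0 := by
  simp [tateEpsilonRat]

/-- With `e = 0`, `HasRSEpsilon … 0 a` is the conjunction of the two `L`-factor statements and of
the functional equation with `γ = 0`; in particular it does not depend on `a`. [folklore] -/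
theorem hasRSEpsilon_zero_iff_hasRSGamma_zero (a : ℤ) :
    HasRSEpsilon hmn π π' ψ μ ν 0 a ↔
      (∃ P Pt : ℂ[X], HasRSLFactor hmn π π' ψ ν P ∧
        HasRSLFactor hmn π.contragredientRep π'.contragredientRep ψ⁻¹ ν Pt) ∧
      HasRSGamma hmn π π' ψ μ ν 0 := by
  simp only [HasRSEpsilon, tateEpsilonRat_zero_left, zero_mul, zero_div]
  constructor
  · rintro ⟨P, Pt, hP, hPt, hγ⟩
    exact ⟨⟨P, Pt, hP, hPt⟩, hγ⟩
  · rintro ⟨⟨P, Pt, hP, hPt⟩, hγ⟩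
    exact ⟨P, Pt, hP, hPt, hγ⟩

/-- `HasRSEpsilon … 0 a` does not depend on the exponent `a`. [folklore] -/
theorem hasRSEpsilon_zero_iff (a b : ℤ) :
    HasRSEpsilon hmn π π' ψ μ ν 0 a ↔ HasRSEpsilon hmn π π' ψ μ ν 0 b := by
  rw [hasRSEpsilon_zero_iff_hasRSGamma_zero, hasRSEpsilon_zero_iff_hasRSGamma_zero]

/-- **Reduction to uniqueness of `ε`** (JPSS 1983, Thm. 2.7 (iii); Cogdell 2004, Thm. 3.2 and
the monomial `c q^{-fs}`): the named fact `existsUnique_hasRSEpsilon` (at the same measures)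
implies `hasRSEpsilon_ne_zero` — were `(0, a)` a pair of `ε`-data, so would be `(0, a + 1)`
(`hasRSEpsilon_zero_iff`), contradicting uniqueness of the pair. Relies on the hypothesis
`huniq : existsUnique_hasRSEpsilon hmn π π' ψ ν μ` (unproved named fact).
[cite: JacquetPiatetskiShapiroShalika1983, Thm. 2.7 (iii)] -/
theorem hasRSEpsilon_ne_zero_of_existsUnique_hasRSEpsilon
    (huniq : existsUnique_hasRSEpsilon hmn π π' ψ ν μ) :
    hasRSEpsilon_ne_zero (hmn := hmn) (π := π) (π' := π') (ψ := ψ) (ν := ν) (μ := μ) := by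
  intro _ _ hπ hπ' hg hg' hψ e a h he
  subst he
  obtain ⟨ea, -, hea⟩ := huniq hπ hπ' hg hg' hψ
  have h1 : ((0 : ℂ), a) = ea := hea (0, a) h
  have h2 : ((0 : ℂ), a + 1) = ea := hea (0, a + 1) ((hasRSEpsilon_zero_iff a (a + 1)).1 h)
  have h3 := congrArg Prod.snd (h1.trans h2.symm)
  simp at h3

/-- **`γ = 0` kills the tilde side**: if the functional equation holds with `γ = 0`, then for
all Whittaker data the tilde integral `t ↦ Ψ̃(t; ρ(w_{n,m}) W̃_v, W̃'_{v'})` (`rsZetaTilde` of the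
functions entering `HasRSGamma`) vanishes on a right half-plane `re t > c` (it equals
`ω_{π'}(-1)^{n-1} · 0 · R = 0` at `t = 1 - s`, `re s < c'`). [folklore] -/
theorem rsZetaTilde_eq_zero_of_hasRSGamma_zero (h : HasRSGamma hmn π π' ψ μ ν 0)
    {Λ : Module.Dual ℂ V} (hΛ : Λ ∈ whittakerFunctionals π ψ)
    {Λ' : Module.Dual ℂ V'} (hΛ' : Λ' ∈ whittakerFunctionals π' ψ⁻¹) (v : V) (v' : V') :
    ∃ c : ℝ, ∀ s : ℂ, c < s.re →
      rsZetaTilde hmn μ ν (fun g => tildeFn (whittakerModel π Λ v) (g * weylNM F hmn.le))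
        (tildeFn (whittakerModel π' Λ' v')) s = 0 := by
  obtain ⟨ω, -, hall⟩ := h
  obtain ⟨R, Rt, -, ⟨c, hc⟩, hRt⟩ := hall Λ hΛ Λ' hΛ' v v'
  rw [mul_zero, zero_mul] at hRt
  subst hRt
  refine ⟨1 - c, fun s hs => ?_⟩
  have h1 := hc (1 - s) (by rw [Complex.sub_re, Complex.one_re]; linarith)
  simpa [evalAtQ] using h1

/-- **The printed argument, core step** (JPSS 1983, Thm. 2.7 (ii)–(iii); Cogdell 2004, §3.1,
Thm. 3.1–3.2): if some finite `ℂ(q^{-s})`-combination of the tilde integrals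
`Ψ̃(s; ρ(w_{n,m}) W̃_{v_i}, W̃'_{v'_i})` (Whittaker data `Λ_i ∈ Hom_U(π, ψ)`, `Λ'_i ∈ Hom_U(π', ψ⁻¹)`)
equals `P(q^{-s})⁻¹` on a right half-plane with `P(0) ≠ 0` — "the `Ψ_{n-m-1}` integrals span a
non-zero fractional ideal" — then any `ε`-data `(e, a)` has `e ≠ 0`: otherwise `γ = 0`, every
tilde integral vanishes for `re s ≫ 0` (`rsZetaTilde_eq_zero_of_hasRSGamma_zero`) while
`P(q^{-j})⁻¹ ≠ 0` at the sample points `s = j ∈ ℕ` large (`exists_forall_lt_re_and_eval_ne_zero`,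
`eval_rsLRat_ne_zero`). No hypothesis on the measures is needed for this implication. [cite: JacquetPiatetskiShapiroShalika1983, Thm. 2.7 (ii)–(iii)] -/
theorem HasRSEpsilon.ne_zero_of_tilde_span
    (hspan : ∃ (P : ℂ[X]) (k : ℕ) (Λ : Fin k → Module.Dual ℂ V) (Λ' : Fin k → Module.Dual ℂ V')
      (v : Fin k → V) (v' : Fin k → V') (Q : Fin k → RatFunc ℂ),
      P.eval 0 ≠ 0 ∧ (∀ i, Λ i ∈ whittakerFunctionals π ψ) ∧
      (∀ i, Λ' i ∈ whittakerFunctionals π' ψ⁻¹) ∧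
      EqOnRightHalfPlane (residueFieldCard F)
        (fun s => ∑ i, evalAtQ (residueFieldCard F) (Q i) s *
          rsZetaTilde hmn μ ν
            (fun g => tildeFn (whittakerModel π (Λ i) (v i)) (g * weylNM F hmn.le))
            (tildeFn (whittakerModel π' (Λ' i) (v' i))) s)
        (rsLRat P))
    {e : ℂ} {a : ℤ} (h : HasRSEpsilon hmn π π' ψ μ ν e a) : e ≠ 0 := by
  intro he
  subst he
  obtain ⟨-, hγ⟩ := (hasRSEpsilon_zero_iff_hasRSGamma_zero a).1 h
  obtain ⟨P, k, Λ, Λ', v, v', Q, hP0, hΛ, hΛ', c₀, hc₀⟩ := hspan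
  choose c hc using fun i => rsZetaTilde_eq_zero_of_hasRSGamma_zero hγ (hΛ i) (hΛ' i) (v i) (v' i)
  have hPne : P ≠ 0 := by
    rintro rfl
    exact hP0 (eval_zero)
  obtain ⟨K, hK⟩ := exists_forall_lt_re_and_eval_ne_zero (one_lt_residueFieldCard F)
    (Sum.elim (fun _ : Unit => c₀) c) (fun _ : Unit => (rsLRat P).denom)
    (fun _ => RatFunc.denom_ne_zero _)
  obtain ⟨hKc, hKd⟩ := hK K le_rfl
  have key := hc₀ (K : ℂ) (hKc (Sum.inl ()))
  dsimp only at key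
  have hzero : ∀ i, rsZetaTilde hmn μ ν
      (fun g => tildeFn (whittakerModel π (Λ i) (v i)) (g * weylNM F hmn.le))
      (tildeFn (whittakerModel π' (Λ' i) (v' i))) (K : ℂ) = 0 :=
    fun i => hc i (K : ℂ) (hKc (Sum.inr i))
  simp only [hzero, mul_zero, Finset.sum_const_zero] at key
  rw [evalAtQ_natCast] at key
  exact eval_rsLRat_ne_zero hPne (hKd ()) key.symm

/-- **`hasRSEpsilon_ne_zero` from the tilde span** (same measures, no measure hypotheses): the
named fact holds at `(μ, ν)` as soon as the tilde-span data exist for all irreducible admissible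
generic `π`, `π'` and non-trivial continuous `ψ` (JPSS 1983, Thm. 2.7 (ii) at `j = n - m - 1`,
transported along `W ↦ ρ(w_{n,m}) W̃`). Relies on `HasRSEpsilon.ne_zero_of_tilde_span`.
[cite: JacquetPiatetskiShapiroShalika1983, Thm. 2.7 (ii)–(iii)] -/
theorem hasRSEpsilon_ne_zero_of_tilde_span
    (hspan : ∀ [π.IsIrreducible] [π'.IsIrreducible], π.IsAdmissible → π'.IsAdmissible →
      IsGeneric π ψ → IsGeneric π' ψ⁻¹ → ψ.IsContinuousNontrivial →
      ∃ (P : ℂ[X]) (k : ℕ) (Λ : Fin k → Module.Dual ℂ V) (Λ' : Fin k → Module.Dual ℂ V')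
        (v : Fin k → V) (v' : Fin k → V') (Q : Fin k → RatFunc ℂ),
        P.eval 0 ≠ 0 ∧ (∀ i, Λ i ∈ whittakerFunctionals π ψ) ∧
        (∀ i, Λ' i ∈ whittakerFunctionals π' ψ⁻¹) ∧
        EqOnRightHalfPlane (residueFieldCard F)
          (fun s => ∑ i, evalAtQ (residueFieldCard F) (Q i) s *
            rsZetaTilde hmn μ ν
              (fun g => tildeFn (whittakerModel π (Λ i) (v i)) (g * weylNM F hmn.le))
              (tildeFn (whittakerModel π' (Λ' i) (v' i))) s)
          (rsLRat P)) :
    hasRSEpsilon_ne_zero (hmn := hmn) (π := π) (π' := π') (ψ := ψ) (ν := ν) (μ := μ) :=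
  fun hπ hπ' hg hg' hψ _ _ h => h.ne_zero_of_tilde_span (hspan hπ hπ' hg hg' hψ)

end EpsilonZero

/-! ### Degeneration at `μ = 0`: the literal fact drops the Haar hypothesis and fails -/

section PiZero

variable {F : Type*} [MeasurableSpace F] {n m : ℕ}

/-- The product measure `0^{⊗ m}` on `M_{(n-m-1) × m}(F)` built from the zero measure on `F` is
the zero measure as soon as `m ≥ 1` and `n - m - 1 ≥ 1`. [folklore] -/
theorem pi_pi_zero_eq_zero (hm : 0 < m) (hj : 0 < n - m - 1) :
    (Measure.pi fun _ : Fin (n - m - 1) => Measure.pi fun _ : Fin m => (0 : Measure F)) = 0 := by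
  have h1 : (Measure.pi fun _ : Fin m => (0 : Measure F)) = 0 := by
    rw [← Measure.measure_univ_eq_zero, Measure.pi_univ]
    simp only [Measure.coe_zero, Pi.zero_apply, Finset.prod_const, Finset.card_univ,
      Fintype.card_fin]
    exact zero_pow hm.ne'
  rw [h1, ← Measure.measure_univ_eq_zero, Measure.pi_univ]
  simp only [Measure.coe_zero, Pi.zero_apply, Finset.prod_const, Finset.card_univ,
    Fintype.card_fin]
  exact zero_pow hj.ne'

end PiZero

section MeasureZero

variable {F : Type*} [Field F] [ValuativeRel F] [TopologicalSpace F]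
  [IsNonarchimedeanLocalField F] {n m : ℕ}
  {V : Type*} [AddCommGroup V] [Module ℂ V] {V' : Type*} [AddCommGroup V'] [Module ℂ V']
  [MeasurableSpace (GL (Fin m) F ⧸ upperUnitriangular (Fin m) F)] [MeasurableSpace F]

/-- At `μ = 0` (`1 ≤ m`, `2 ≤ n - m`) the modified zeta integral `Ψ_{n-m-1}` vanishes
identically: its inner `x`-integral is against the zero measure. [folklore] -/
theorem rsZetaTilde_measure_zero (hmn : m < n) (hm : 0 < m) (hj : 0 < n - m - 1)
    (ν : Measure (GL (Fin m) F ⧸ upperUnitriangular (Fin m) F))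
    (W : GL (Fin n) F → ℂ) (W' : GL (Fin m) F → ℂ) (s : ℂ) :
    rsZetaTilde hmn (0 : Measure F) ν W W' s = 0 := by
  have h0 : (fun y : GL (Fin n) F => ∫ x : Fin (n - m - 1) → Fin m → F, W (y * lowerShear n m x)
      ∂(Measure.pi fun _ => Measure.pi fun _ => (0 : Measure F))) = 0 := by
    funext y
    rw [pi_pi_zero_eq_zero hm hj, integral_zero_measure]
    rfl
  rw [rsZetaTilde, h0, rsZeta]
  have hint : IsRightUInvariant (rsIntegrand hmn (0 : GL (Fin n) F → ℂ) W' s) := fun g u => by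
    simp [rsIntegrand]
  have hker : rsKernel hmn (0 : GL (Fin n) F → ℂ) W' s = 0 := by
    funext x
    induction x using QuotientGroup.induction_on with
    | H g => rw [rsKernel_mk hmn hint]; simp [rsIntegrand]
  rw [hker]
  exact integral_zero _ _

variable {hmn : m < n} {π : Representation ℂ (GL (Fin n) F) V}
  {π' : Representation ℂ (GL (Fin m) F) V'} {ψ : AddChar F Circle}
  {ν : Measure (GL (Fin m) F ⧸ upperUnitriangular (Fin m) F)}

/-- At `μ = 0` (`1 ≤ m`, `2 ≤ n - m`) the functional equation `HasRSGamma` holds with `γ = 0`,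
given a central character of `π'` and the `L`-factor statement for `(π, π')` at `ν` (which
supplies the rational functions interpolating the `j = 0` integrals). [folklore] -/
theorem hasRSGamma_zero_measure_zero (hm : 0 < m) (hj : 0 < n - m - 1)
    {ω : Subgroup.center (GL (Fin m) F) →* ℂˣ} (hω : π'.HasCentralCharacter ω)
    {P : ℂ[X]} (hP : HasRSLFactor hmn π π' ψ ν P) :
    HasRSGamma hmn π π' ψ (0 : Measure F) ν 0 := by
  refine ⟨ω, hω, fun Λ hΛ Λ' hΛ' v v' => ?_⟩
  obtain ⟨R, -, hR⟩ := hP.2.1 Λ hΛ Λ' hΛ' v v'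
  refine ⟨R * rsLRat P, 0, hR, ⟨0, fun s _ => ?_⟩, by rw [mul_zero, zero_mul]⟩
  dsimp only
  rw [rsZetaTilde_measure_zero hmn hm hj]
  simp [evalAtQ]

/-- At `μ = 0` (`1 ≤ m`, `2 ≤ n - m`), `(0, a)` is `ε`-data for EVERY `a : ℤ` as soon as the two
`L`-factor statements hold at `ν` and `π'` has a central character. [folklore] -/
theorem hasRSEpsilon_zero_measure_zero (hm : 0 < m) (hj : 0 < n - m - 1)
    {ω : Subgroup.center (GL (Fin m) F) →* ℂˣ} (hω : π'.HasCentralCharacter ω)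
    {P Pt : ℂ[X]} (hP : HasRSLFactor hmn π π' ψ ν P)
    (hPt : HasRSLFactor hmn π.contragredientRep π'.contragredientRep ψ⁻¹ ν Pt) (a : ℤ) :
    HasRSEpsilon hmn π π' ψ (0 : Measure F) ν 0 a := by
  refine ⟨P, Pt, hP, hPt, ?_⟩
  rw [show tateEpsilonRat 0 a * rsLRatDual F Pt / rsLRat P = 0 by simp [tateEpsilonRat]]
  exact hasRSGamma_zero_measure_zero hm hj hω hP

/-- **The literal named fact `hasRSEpsilon_ne_zero` fails at `μ = 0`** (`1 ≤ m`, `2 ≤ n - m`):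
for irreducible admissible generic `π`, `π'`, a non-trivial continuous `ψ`, a central character
of `π'` (Schur's lemma, `Representation.exists_hasCentralCharacter`) and the `L`-factor
statements of JPSS Thm. 2.7 (i)–(ii) for `(π, π')` and `(π̃, π̃')` at `ν`
(`existsUnique_hasRSLFactor`), the `Prop` `hasRSEpsilon_ne_zero` instantiated at the zero
measure `μ = 0` is false (`hasRSEpsilon_zero_measure_zero` exhibits `ε`-data `(0, 0)`). The
mechanical rewrite that produced the `def` dropped the binder `[μ.IsAddHaarMeasure]` (and the
invariance/regularity binders on `ν`) of the original statement; see the module docstring. [folklore] -/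
theorem not_hasRSEpsilon_ne_zero_measure_zero (hm : 0 < m) (hj : 0 < n - m - 1)
    [π.IsIrreducible] [π'.IsIrreducible] (hπ : π.IsAdmissible) (hπ' : π'.IsAdmissible)
    (hg : IsGeneric π ψ) (hg' : IsGeneric π' ψ⁻¹) (hψ : ψ.IsContinuousNontrivial)
    {ω : Subgroup.center (GL (Fin m) F) →* ℂˣ} (hω : π'.HasCentralCharacter ω)
    {P Pt : ℂ[X]} (hP : HasRSLFactor hmn π π' ψ ν P)
    (hPt : HasRSLFactor hmn π.contragredientRep π'.contragredientRep ψ⁻¹ ν Pt) :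
    ¬ hasRSEpsilon_ne_zero (hmn := hmn) (π := π) (π' := π') (ψ := ψ) (ν := ν)
      (μ := (0 : Measure F)) :=
  fun h => h hπ hπ' hg hg' hψ (hasRSEpsilon_zero_measure_zero hm hj hω hP hPt 0) rfl

end MeasureZero

end Literature.NumberTheory.Automorphic
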